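import Summits.QuantumFields.YangMills.Theorems.BalabanUVNodesN15VectorPieceGenuineSite
import HarnessLib

/-!
# Route «BalabanUVNodes» (K4 «SpineRates»), node N15 = NE2 — THE `_rel` UNIT DATUM INHABITED BY KING's FORM OF BAŁABAN's FULL `U ≡ 1` LANDAU-GAUGE PROPAGATOR (`⊗ 1_𝔤`) ON
# THE TORUS FAMILY OF RECORD, AND `N15At` — ALL THREE CONJUNCTS BY NAME — FOR THE BACKGROUND-LIVE (3.60)-WORDS FAMILY WITH BOTH `U ≡ 1` LAYERS GENUINE

Cell `pub-ymgap`, seat `pub-ymgap-dag-n15-c` (generation g7; R134 ACCELERATION SEAT, strategy s1; HUMAN RULING D-0062; chair R424 venue; `bears_on: R4∕N15`).  Filed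
`--kind proof --supports stmt-QuantumFields-20509 --as helper` (K3⁶ `SpineGivenEndpointR13SepCoPR`, dag-lead WORDS-142; count-neutral).  Imports BY NAME this seat's G2
`…N15VectorPieceGenuineSite` (`IsRecordIndex`, `siteRelDatum_genuine`, `genuine{Ks,Ws}V(′)`; → R3s `n15At_vectorPiece_vWordsExpC_of_rel`, R3u `UnitRelDatum`, E2 `ownUnitInv` ∕
`unitForm₀_comp_ownUnitInv` ∕ `hasMaj_ownUnitInv`, R1 `hasMaj_idef_unitForm₀`, M4 `tensorId` ∕ `hasMaj_tensorId` ∕ `idef_tensorId`, F4 `card_fibre_kingPrV_lift`, E4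
`ne2ZeroUnit_vectorPiece_vWordsExpC_rel`; dag-n15-a part 42 `ineq110_114_pair` ∕ `hasMaj_gOp_of_ineq` ((1.110) majorants of `gOp = Δ_b⁻¹`), part 52 `hasMaj_twoGridDefect`
(ENTRY 0 of `𝔇(G′, G)`), part 26 `blkFine_comp_kingPrV`); nothing in the tree is modified.

WHY.  G2 put the GENUINE `U ≡ 1` SITE form (`Q′G′²Q′* ⊗ 1`) into the seat's relative site layer; the relative UNIT layer (R3u `UnitRelDatum`) was served by the PIECE's own form
`a·1 − a²Q(G_piece ⊗ 1)Q*` (E2) — honest, but the form of ONE single-scale piece, not of the propagator.  The genuine `U ≡ 1` unit form is King's `Δ^{(k)} = a·1 − a²·Q G Q*`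
((2.14) p.653) with the FULL propagator; at `U ≡ 1` the full Landau-gauge `G = Δ_b⁻¹` on real 1-forms is dag-n15-a's `gOp` with its (1.110) majorants and ENTRY 0 of `𝔇(G′, G)`
PROVED on the torus family of record — exactly the two inputs E2's Neumann device and R1's defect lemma consume.  This file types that datum (`⊗ 1_𝔤`), and closes `N15At` for the
background-live (3.60)-words family with BOTH `U ≡ 1` layers genuine.

WHAT THIS FILE IS (ns `Summit.QuantumFields.YangMills.BalabanUVNodes.N15.VectorPiece`).
* §1 `fullG_letters_of_eq` — dag-n15-a's three `U ≡ 1` letters of the full pair (coarse∕fine (1.110) majorants at ONE rate, ENTRY 0 at `γ = ½`) restated for ANY period vector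
  `M = MP (paramsOf d L m_T k hL)` (a `subst` wrapper, so that they apply at the seat's indices `j` with `j.Mn μ = 2L^{m_T}`), fine blocking `blkFine ∘ prV` (part 26).
* §2 the GENUINE UNIT DATA `genuineKuV ∕ genuineKuV′ ∕ genuineWuV ∕ genuineWuV′ ι L b a j`: King's forms `unitForm₀ a Q (gOp ⊗ 1)` at both spacings and their Neumann inverses
  `ownUnitInv` (E2) at every index of record, the identity elsewhere (R4's trivial datum, said); ★★ **`unitRelDatum_genuineKing`**: for `d + 1 ≥ 1`, odd `L ≥ 3`, `b > 0` there is
  `a₀ > 0` such that for every weight `a ≠ 0`, `|a| ≤ a₀`: `∃ βU δU M₀, UnitRelDatum (genuineWuV …) (genuineWuV′ …) (genuineKuV …) (genuineKuV′ …) βU δU M₀` — E2's `unitData_own`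
  argument VERBATIM with the piece replaced by `gOp ⊗ 1_ι` (M4 `hasMaj_tensorId` ∕ `idef_tensorId` lifts; `card_fibre_kingPrV_lift`); `genuineWeightBound` (+`_pos`, `_spec`).
* §3 ★★★ **`n15At_vectorPiece_vWordsExpC_genuineBoth`**: `N15At` with `Kop := vWGCVecFamily4` (F16), `Ksite :=` G2's genuine site datum, `Kunit :=` this file's genuine unit datum —
  ALL THREE CONJUNCTS BY NAME, background LIVE (gauge field the datum, (3.35) smallness), BOTH `U ≡ 1` forms the genuine ones of Bałaban's full propagator on the family of record
  (R3s `n15At_vectorPiece_vWordsExpC_of_rel` at the two genuine data); `ne2ZeroUnit_vectorPiece_vWordsExpC_genuineKing` (E4's corollary); closer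
  `s_N15_of_vWordsExpCGenuineBothReading`.

HONEST FRAMING ∕ LIMITS.  As G2: the dressed unit kernel is S1∕R1's `[Ku + P_u(A′)]⁻¹` with `Ku` King's form of the FULL `U ≡ 1` propagator `⊗ 1_𝔤` and `P_u(A′)` the dressing words of
the -a LINEAR single-scale piece (two different `U ≡ 1` propagators in one form — MODEL-LEVEL, said); identity datum off the family of record; the unit inverse by a Neumann series,
hence a small-weight window only (King's positivity (4.33) p.674 not used; printed normalisations of [B6] (2.156) ∕ King (2.16) not tracked); fixed coupling `b`.  NE2⁺ NOT PRINTED,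
NOT proved for Bałaban's `G(U)`; count-neutral (typed 28∕28 · discharged 5∕27 of record unchanged); N15 NOT discharged; one finite T⁴ at fixed ε — NOT ℝ⁴, NOT infinite volume,
NOT OS, NOT a mass gap, NOT Clay.
-/

noncomputable section

open scoped BigOperators
open Finset

namespace Summit.QuantumFields.YangMills.BalabanUVNodes.N15.VectorPiece

open Literature.MathematicalPhysics.QuantumFieldTheory.Balaban1983to89
open Literature.MathematicalPhysics.QuantumFieldTheory.Balaban1983to89.B11SectG (BlockNorm HasMaj RowSum hasMaj_zero)
open Literature.MathematicalPhysics.QuantumFieldTheory.Balaban1983to89.B6RandomWalk (Triangle254)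
open Literature.MathematicalPhysics.QuantumFieldTheory.Balaban1983to89.T4Continuum
open Literature.MathematicalPhysics.QuantumFieldTheory.Balaban1983to89.T4EtaRate (PairedInstance NE2PlusUnit)
open Literature.MathematicalPhysics.QuantumFieldTheory.Balaban1983to89.T4EtaRateUnitWitness (NE2ZeroUnit)
open Literature.MathematicalPhysics.QuantumFieldTheory.Balaban1983to89.T4EtaRateDefect (idef)
open Literature.MathematicalPhysics.QuantumFieldTheory.Balaban1983to89.T4EtaRateCoeffDefect (pull fibre)
open Literature.MathematicalPhysics.QuantumFieldTheory.Balaban1983to89.B5Prop11Plancherel (Tor fine)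
open Literature.MathematicalPhysics.QuantumFieldTheory.Balaban1983to89.B5SiteBridgeP12 (MP)
open Literature.MathematicalPhysics.QuantumFieldTheory.Balaban1983to89.B6UnitTorusCarrier (unitTorusGeo triangle254_unitTorusGeo rowSum_unitTorusGeo)
open Literature.MathematicalPhysics.QuantumFieldTheory.Balaban1983to89.B9Eq3130MatrixLetters (hasMaj_id_ofBlocks)
open Literature.MathematicalPhysics.QuantumFieldTheory.King1986.Torus (blockOf tdistT tdistT_nonneg tdistT_self)
open Summit.QuantumFields.YangMills.BalabanUVNodes.N15.MatrixSpecies (liftMap liftBlk)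
open Summit.QuantumFields.YangMills.BalabanUVNodes.N15.SiteLayer (unitForm₀ ownUnitInv unitForm₀_comp_ownUnitInv hasMaj_ownUnitInv hasMaj_idef_unitForm₀ hasMaj_exp_mono)
open Summit.QuantumFields.YangMills.BalabanUVNodes.N15.GenuineSite (idef_id_id_eq)
open Summit.QuantumFields.YangMills.BalabanUVNodes.N15.TwoGrid (gOp hasMaj_twoGridDefect ineq110_114_pair hasMaj_gOp_of_ineq paramsOf)
open YMDAG.UVSplit (N15At RateCarriers RateRecordPred S_N15 Datum)

variable {d : ℕ}

/-! ## §1 The full pair's three `U ≡ 1` letters at any period vector of the family of record -/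

section FullG

variable {L : ℕ} [NeZero L]

/-- **THE FULL PAIR's `U ≡ 1` LETTERS AT A PERIOD VECTOR OF RECORD** (`M = MP (paramsOf d L m_T k hL)`; a `subst` wrapper of dag-n15-a's theorems): for odd `L ≥ 3`, `b > 0`
there are `δ, C₀, C₂ > 0` with, for every `m_T`, `k ≥ 1`, `m` and such `M`: `G = gOp M (L^k) b ≤ C₀·e^{−δ|y−y′|_T}`, `G′ = gOp M (L^m·L^k) b ≤ C₀·e^{−δ|y−y′|_T}` (fine bonds blocked
by `blkFine ∘ prV`), `𝔇(G′, G) ≤ C₂·(L^k)^{−¼}·e^{−δ|y−y′|_T}` — (1.110) both grids (`ineq110_114_pair`, `hasMaj_gOp_of_ineq`) and ENTRY 0 (`hasMaj_twoGridDefect` at `γ = ½`) at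
ONE rate. [cite: Balaban1984PropagatorsI, Prop. 1.2 (1.110) p.35; King1986, Prop. 3.8 (3.71) p.664 (rate shape)] -/
theorem fullG_letters_of_eq (hLodd : Odd L) (hL2 : 2 ≤ L) (hL : Odd L ∧ 1 < L) {b : ℝ} (hb : 0 < b) :
    ∃ δ C₀ C₂ : ℝ, 0 < δ ∧ 0 < C₀ ∧ 0 < C₂ ∧ ∀ (mT k m : ℕ) (_hk : 1 ≤ k) (M : Fin (d + 1) → ℕ) [∀ μ, NeZero (M μ)] (_hM : M = MP (paramsOf d L mT k hL)),
      HasMaj (BlockNorm.ofBlocks (unitTorusGeo L k M) (blkFine L k M)) (BlockNorm.ofBlocks (unitTorusGeo L k M) (blkFine L k M)) (gOp M (L ^ k) b)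
          (fun y y' => C₀ * Real.exp (-(δ * tdistT M y y'))) ∧
      HasMaj (BlockNorm.ofBlocks (unitTorusGeo L k M) (blkFine L k M ∘ kingPrV L k m M)) (BlockNorm.ofBlocks (unitTorusGeo L k M) (blkFine L k M ∘ kingPrV L k m M))
          (gOp M (L ^ m * L ^ k) b) (fun y y' => C₀ * Real.exp (-(δ * tdistT M y y'))) ∧
      HasMaj (BlockNorm.ofBlocks (unitTorusGeo L k M) (blkFine L k M)) (BlockNorm.ofBlocks (unitTorusGeo L k M) (blkFine L k M ∘ kingPrV L k m M))
          (idef (pull (kingPrV L k m M)) (pull (kingPrV L k m M)) (gOp M (L ^ m * L ^ k) b) (gOp M (L ^ k) b))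
          (fun y y' => C₂ * ((L : ℝ) ^ k) ^ (-(1 / 4 : ℝ)) * Real.exp (-(δ * tdistT M y y'))) := by
  obtain ⟨δ₀, C₀, Cα, Cε, Cαε, hδ₀, hC₀, HP⟩ := ineq110_114_pair (d := d) hL hb
  obtain ⟨δ₂, C₂, hδ₂, hC₂, H0⟩ := hasMaj_twoGridDefect (d := d) hLodd hL2 hb (γ := 1 / 2) (by norm_num) (by norm_num)
  have hL0 : 0 < L := by omega
  refine ⟨min δ₀ δ₂, C₀, C₂, lt_min hδ₀ hδ₂, hC₀, hC₂, fun mT k m hk M _ hM => ?_⟩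
  subst hM
  set M : Fin (d + 1) → ℕ := MP (paramsOf d L mT k hL) with hMdef
  have hn1 : 1 ≤ L ^ k := Nat.one_le_pow _ _ hL0
  have hn'1 : 1 ≤ L ^ m * L ^ k := Nat.one_le_iff_ne_zero.mpr (Nat.mul_ne_zero (pow_ne_zero _ (NeZero.ne L)) (pow_ne_zero _ (NeZero.ne L)))
  have hdist : ∀ y y' : (unitTorusGeo L k M).Site, 0 ≤ (unitTorusGeo L k M).dist y y' := fun y y' => tdistT_nonneg _ _ _
  obtain ⟨HP1, HP2⟩ := HP mT k m hk
  have hθ : 0 ≤ ((L : ℝ) ^ k) ^ (-(1 / 4 : ℝ)) := Real.rpow_nonneg (pow_nonneg (Nat.cast_nonneg _) _) _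
  refine ⟨hasMaj_exp_mono hdist hC₀.le (min_le_left _ _) (hasMaj_gOp_of_ineq M k (L ^ k) b hn1 HP1 hC₀.le), ?_, ?_⟩
  · rw [blkFine_comp_kingPrV M L k m]
    exact hasMaj_exp_mono hdist hC₀.le (min_le_left _ _) (hasMaj_gOp_of_ineq M k (L ^ m * L ^ k) b hn'1 HP2 hC₀.le)
  · rw [blkFine_comp_kingPrV M L k m]
    have e0 := H0 mT k m hk hL
    have hcast : ((L ^ k : ℕ) : ℝ) = (L : ℝ) ^ k := by push_cast; ring
    have hq : (-((1 : ℝ) / 2 / 2)) = -(1 / 4) := by norm_num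
    rw [hcast, hq] at e0
    exact hasMaj_exp_mono hdist (mul_nonneg hC₂.le hθ) (min_le_right _ _) e0

end FullG

/-! ## §2 The genuine unit data on the seat's index family and ★★ `unitRelDatum_genuineKing` -/

section Datum

variable (ι : Type) [Fintype ι] (L : ℕ) [NeZero L] (b a : ℝ)

open Classical in
/-- KING's COARSE UNIT FORM `a·1 − a²·Q(G ⊗ 1)Q*` OF THE FULL `U ≡ 1` PROPAGATOR `G = gOp (L^k) b` (lifted to `𝔤 ≅ ℝ^ι`-valued 1-forms) at every index of record; the identity form at
the other indices. [cite: King1986, (2.14) p.653 (shape); Balaban1984PropagatorsI, (1.71) p.30 (the propagator)] -/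
def genuineKuV (j : VecIndexS d L) : ((Tor j.Mn × Fin (d + 1)) × ι → ℝ) →ₗ[ℝ] ((Tor j.Mn × Fin (d + 1)) × ι → ℝ) :=
  if IsRecordIndex L j then unitForm₀ a (liftMap (qbond L j.k j.Mn) ι) (tensorId ι (gOp j.Mn (L ^ j.k) b)) else LinearMap.id

open Classical in
/-- KING's FINE UNIT FORM of `gOp (L^m·L^k) b ⊗ 1` (blocking through King's bond pairing) at every index of record; the identity elsewhere. [cite: King1986, (2.14) p.653, p.664] -/
def genuineKuV' (j : VecIndexS d L) : ((Tor j.Mn × Fin (d + 1)) × ι → ℝ) →ₗ[ℝ] ((Tor j.Mn × Fin (d + 1)) × ι → ℝ) :=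
  if IsRecordIndex L j then
    unitForm₀ a (liftMap (qbond L j.k j.Mn) ι ∘ liftMap (kingPrV L j.k j.m j.Mn) ι) (tensorId ι (gOp j.Mn (L ^ j.m * L ^ j.k) b))
  else LinearMap.id

open Classical in
/-- THE COARSE UNIT-LATTICE COVARIANCE `(a·1 − a²Q(G ⊗ 1)Q*)⁻¹` of the full propagator (E2's Neumann inverse) at every index of record; the identity elsewhere.
[cite: King1986, (2.16) p.653 (shape); Balaban1985BackgroundPropagators, (3.67) p.403 (Neumann mechanism)] -/
def genuineWuV (j : VecIndexS d L) : ((Tor j.Mn × Fin (d + 1)) × ι → ℝ) →ₗ[ℝ] ((Tor j.Mn × Fin (d + 1)) × ι → ℝ) :=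
  if IsRecordIndex L j then ownUnitInv a (liftMap (qbond L j.k j.Mn) ι) (tensorId ι (gOp j.Mn (L ^ j.k) b)) else LinearMap.id

open Classical in
/-- THE FINE UNIT-LATTICE COVARIANCE of the full propagator at every index of record; the identity elsewhere. [cite: King1986, (2.16) p.653 (shape)] -/
def genuineWuV' (j : VecIndexS d L) : ((Tor j.Mn × Fin (d + 1)) × ι → ℝ) →ₗ[ℝ] ((Tor j.Mn × Fin (d + 1)) × ι → ℝ) :=
  if IsRecordIndex L j then
    ownUnitInv a (liftMap (qbond L j.k j.Mn) ι ∘ liftMap (kingPrV L j.k j.m j.Mn) ι) (tensorId ι (gOp j.Mn (L ^ j.m * L ^ j.k) b))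
  else LinearMap.id

variable {ι L b a}

/-- ★★ **THE `_rel` UNIT DATUM IS INHABITED BY KING's FORM OF THE FULL `U ≡ 1` PROPAGATOR.**  For odd `L ≥ 3` and `b > 0` there is a weight window `a₀ > 0` such that for every
`a ≠ 0` with `|a| ≤ a₀`: `∃ βU δU M₀, UnitRelDatum (genuineWuV ι L b a) (genuineWuV′ ι L b a) (genuineKuV ι L b a) (genuineKuV′ ι L b a) βU δU M₀` — at every index of record E2's
`unitData_own` argument with the piece replaced by `gOp ⊗ 1_ι`: inverse majorant `hasMaj_ownUnitInv` and `Δ·C = 1` `unitForm₀_comp_ownUnitInv` on the lifted (1.110) majorants,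
η-defect of the forms R1 `hasMaj_idef_unitForm₀` on the lifted ENTRY 0 (`idef_tensorId`, `hasMaj_tensorId`, `card_fibre_kingPrV_lift`); at the other indices R4's identity letters.
[cite: King1986, (2.14)+(2.16) p.653, Lemma 4.5 (4.34)+(4.38) p.674 (shapes); Balaban1984PropagatorsI, Prop. 1.2 (1.110) p.35; Balaban1985BackgroundPropagators, (3.67) p.403] -/
theorem unitRelDatum_genuineKing (hLodd : Odd L) (hL2 : 2 ≤ L) {b : ℝ} (hb : 0 < b) :
    ∃ a₀ : ℝ, 0 < a₀ ∧ ∀ a : ℝ, a ≠ 0 → |a| ≤ a₀ → ∃ βU δU M₀ : ℝ,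
      UnitRelDatum (d := d) (ι := ι) (L := L) (genuineWuV ι L b a) (genuineWuV' ι L b a) (genuineKuV ι L b a) (genuineKuV' ι L b a) βU δU M₀ := by
  classical
  have hL : Odd L ∧ 1 < L := ⟨hLodd, by omega⟩
  have hL1 : 1 ≤ L := by omega
  obtain ⟨δ, C₀, C₂, hδ, hC₀, hC₂, HF⟩ := fullG_letters_of_eq (d := d) hLodd hL2 hL hb
  -- row-sum rate σ = δ/4, inverse rate δ/2 (E2's choices)
  set σ : ℝ := δ / 4 with hσdef
  have hσ : 0 < σ := by positivity
  set cr : ℝ := B4Sect5Proof.latticeConst (d + 1) σ with hcrdef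
  have hcr : 0 ≤ cr := B4Sect5Proof.latticeConst_nonneg (d + 1) hσ.le
  refine ⟨(2 * (C₀ * cr * cr + 1))⁻¹, by positivity, fun a ha haa => ?_⟩
  have hapos : 0 < |a| := abs_pos.mpr ha
  have hsmall : |a| * C₀ * cr * cr < 1 := by
    have h1 : |a| * (C₀ * cr * cr) ≤ (2 * (C₀ * cr * cr + 1))⁻¹ * (C₀ * cr * cr) := mul_le_mul_of_nonneg_right haa (by positivity)
    have h2 : (2 * (C₀ * cr * cr + 1))⁻¹ * (C₀ * cr * cr) < 1 := by
      rw [inv_mul_lt_iff₀ (by positivity)]; nlinarith [mul_nonneg (mul_nonneg hC₀.le hcr) hcr]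
    nlinarith
  have hq1 : 0 < 1 - |a| * C₀ * cr * cr := by linarith
  set βU : ℝ := max (|a⁻¹| * (1 - |a| * C₀ * cr * cr)⁻¹) 1 with hβUdef
  have hβU : 0 ≤ βU := zero_le_one.trans (le_max_right _ _)
  have hδ2 : 0 < δ / 2 := by positivity
  have hM₀ : 0 ≤ a * a * C₂ := mul_nonneg (mul_self_nonneg a) hC₂.le
  have hθ0 : ∀ j : VecIndexS d L, 0 ≤ thetaV L j := fun j => by unfold thetaV; positivity
  have hdist : ∀ (j : VecIndexS d L) (y y' : (unitTorusGeoS L j.k j.Mn j.Msz).Site), 0 ≤ (unitTorusGeoS L j.k j.Mn j.Msz).dist y y' :=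
    fun j y y' => tdistT_nonneg _ _ _
  have hd0 : ∀ (j : VecIndexS d L) (y : (unitTorusGeoS L j.k j.Mn j.Msz).Site), (unitTorusGeoS L j.k j.Mn j.Msz).dist y y = 0 := fun j y => tdistT_self _ _
  -- the identity datum's letters (R4)
  have hId : ∀ j : VecIndexS d L, HasMaj (BlockNorm.ofBlocks (unitTorusGeoS L j.k j.Mn j.Msz) (liftBlk (fun p : Tor j.Mn × Fin (d + 1) => p.1) ι))
      (BlockNorm.ofBlocks (unitTorusGeoS L j.k j.Mn j.Msz) (liftBlk (fun p : Tor j.Mn × Fin (d + 1) => p.1) ι)) LinearMap.id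
      (fun y y' => βU * Real.exp (-(δ / 2 * (unitTorusGeoS L j.k j.Mn j.Msz).dist y y'))) := fun j =>
    (hasMaj_id_ofBlocks (g := unitTorusGeoS L j.k j.Mn j.Msz) (liftBlk (fun p : Tor j.Mn × Fin (d + 1) => p.1) ι) (fun y => tdistT_self j.Mn y) (δ / 2)).mono
      fun y y' => mul_le_mul_of_nonneg_right (le_max_right _ _) (Real.exp_nonneg _)
  -- the genuine letters at an index of record
  have hRec : ∀ j : VecIndexS d L, IsRecordIndex L j →
      HasMaj (BlockNorm.ofBlocks (unitTorusGeoS L j.k j.Mn j.Msz) (liftBlk (fun p : Tor j.Mn × Fin (d + 1) => p.1) ι))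
          (BlockNorm.ofBlocks (unitTorusGeoS L j.k j.Mn j.Msz) (liftBlk (fun p : Tor j.Mn × Fin (d + 1) => p.1) ι))
          (ownUnitInv a (liftMap (qbond L j.k j.Mn) ι) (tensorId ι (gOp j.Mn (L ^ j.k) b)))
          (fun y y' => βU * Real.exp (-(δ / 2 * (unitTorusGeoS L j.k j.Mn j.Msz).dist y y'))) ∧
      HasMaj (BlockNorm.ofBlocks (unitTorusGeoS L j.k j.Mn j.Msz) (liftBlk (fun p : Tor j.Mn × Fin (d + 1) => p.1) ι))
          (BlockNorm.ofBlocks (unitTorusGeoS L j.k j.Mn j.Msz) (liftBlk (fun p : Tor j.Mn × Fin (d + 1) => p.1) ι))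
          (ownUnitInv a (liftMap (qbond L j.k j.Mn) ι ∘ liftMap (kingPrV L j.k j.m j.Mn) ι) (tensorId ι (gOp j.Mn (L ^ j.m * L ^ j.k) b)))
          (fun y y' => βU * Real.exp (-(δ / 2 * (unitTorusGeoS L j.k j.Mn j.Msz).dist y y'))) ∧
      unitForm₀ a (liftMap (qbond L j.k j.Mn) ι) (tensorId ι (gOp j.Mn (L ^ j.k) b)) ∘ₗ ownUnitInv a (liftMap (qbond L j.k j.Mn) ι) (tensorId ι (gOp j.Mn (L ^ j.k) b)) =
          LinearMap.id ∧
      unitForm₀ a (liftMap (qbond L j.k j.Mn) ι ∘ liftMap (kingPrV L j.k j.m j.Mn) ι) (tensorId ι (gOp j.Mn (L ^ j.m * L ^ j.k) b)) ∘ₗ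
          ownUnitInv a (liftMap (qbond L j.k j.Mn) ι ∘ liftMap (kingPrV L j.k j.m j.Mn) ι) (tensorId ι (gOp j.Mn (L ^ j.m * L ^ j.k) b)) = LinearMap.id ∧
      HasMaj (BlockNorm.ofBlocks (unitTorusGeoS L j.k j.Mn j.Msz) (liftBlk (fun p : Tor j.Mn × Fin (d + 1) => p.1) ι))
          (BlockNorm.ofBlocks (unitTorusGeoS L j.k j.Mn j.Msz) (liftBlk (fun p : Tor j.Mn × Fin (d + 1) => p.1) ι))
          (idef LinearMap.id LinearMap.id
            (unitForm₀ a (liftMap (qbond L j.k j.Mn) ι ∘ liftMap (kingPrV L j.k j.m j.Mn) ι) (tensorId ι (gOp j.Mn (L ^ j.m * L ^ j.k) b)))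
            (unitForm₀ a (liftMap (qbond L j.k j.Mn) ι) (tensorId ι (gOp j.Mn (L ^ j.k) b))))
          (fun y y' => a * a * C₂ * thetaV L j * Real.exp (-(δ / 2 * (unitTorusGeoS L j.k j.Mn j.Msz).dist y y'))) := by
    intro j hj
    obtain ⟨hk, mT, hM⟩ := hj
    have hMeq : j.Mn = MP (paramsOf d L mT j.k hL) := funext fun μ => (hM μ).trans rfl
    obtain ⟨hG, hG', hDG⟩ := HF mT j.k j.m hk j.Mn hMeq
    haveI : NeZero (L ^ j.m * L ^ j.k) := ⟨Nat.mul_ne_zero (pow_ne_zero _ (NeZero.ne L)) (pow_ne_zero _ (NeZero.ne L))⟩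
    have hC₀e : ∀ y y' : Tor j.Mn, 0 ≤ C₀ * Real.exp (-(δ * tdistT j.Mn y y')) := fun y y' => mul_nonneg hC₀.le (Real.exp_nonneg _)
    have hme : ∀ y y' : Tor j.Mn, 0 ≤ C₂ * ((L : ℝ) ^ j.k) ^ (-(1 / 4 : ℝ)) * Real.exp (-(δ * tdistT j.Mn y y')) := fun y y' =>
      mul_nonneg (mul_nonneg hC₂.le (Real.rpow_nonneg (pow_nonneg (Nat.cast_nonneg _) _) _)) (Real.exp_nonneg _)
    -- the lifted letters on the sized carrier
    have hGι : HasMaj (BlockNorm.ofBlocks (unitTorusGeoS L j.k j.Mn j.Msz) (liftBlk (blkFine L j.k j.Mn) ι))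
        (BlockNorm.ofBlocks (unitTorusGeoS L j.k j.Mn j.Msz) (liftBlk (blkFine L j.k j.Mn) ι)) (tensorId ι (gOp j.Mn (L ^ j.k) b))
        (fun y y' => C₀ * Real.exp (-(δ * (unitTorusGeoS L j.k j.Mn j.Msz).dist y y'))) := hasMaj_tensorId ι hC₀e hG
    have hG'ι : HasMaj (BlockNorm.ofBlocks (unitTorusGeoS L j.k j.Mn j.Msz) (liftBlk (blkFine L j.k j.Mn ∘ kingPrV L j.k j.m j.Mn) ι))
        (BlockNorm.ofBlocks (unitTorusGeoS L j.k j.Mn j.Msz) (liftBlk (blkFine L j.k j.Mn ∘ kingPrV L j.k j.m j.Mn) ι)) (tensorId ι (gOp j.Mn (L ^ j.m * L ^ j.k) b))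
        (fun y y' => C₀ * Real.exp (-(δ * (unitTorusGeoS L j.k j.Mn j.Msz).dist y y'))) := hasMaj_tensorId ι hC₀e hG'
    have hDGι : HasMaj (BlockNorm.ofBlocks (unitTorusGeoS L j.k j.Mn j.Msz) (liftBlk (blkFine L j.k j.Mn) ι))
        (BlockNorm.ofBlocks (unitTorusGeoS L j.k j.Mn j.Msz) (liftBlk (blkFine L j.k j.Mn) ι ∘ liftMap (kingPrV L j.k j.m j.Mn) ι))
        (idef (pull (liftMap (kingPrV L j.k j.m j.Mn) ι)) (pull (liftMap (kingPrV L j.k j.m j.Mn) ι)) (tensorId ι (gOp j.Mn (L ^ j.m * L ^ j.k) b))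
          (tensorId ι (gOp j.Mn (L ^ j.k) b)))
        (fun y y' => C₂ * ((L : ℝ) ^ j.k) ^ (-(1 / 4 : ℝ)) * Real.exp (-(δ * (unitTorusGeoS L j.k j.Mn j.Msz).dist y y'))) := by
      rw [idef_tensorId]; exact hasMaj_tensorId ι hme hDG
    have htri := triangle254_unitTorusGeo L j.k j.Mn
    have hrow := rowSum_unitTorusGeo L j.k j.Mn hσ
    refine ⟨?_, ?_, ?_, ?_, ?_⟩
    · exact (hasMaj_ownUnitInv (g := unitTorusGeoS L j.k j.Mn j.Msz) (liftBlk (fun p : Tor j.Mn × Fin (d + 1) => p.1) ι) (liftBlk (blkFine L j.k j.Mn) ι)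
        (liftMap (qbond L j.k j.Mn) ι) (fun _ => rfl) htri (hdist j) (hd0 j) hrow hσ.le hcr ha hC₀.le hδ2.le (by linarith) hGι hsmall).mono
        fun y y' => mul_le_mul_of_nonneg_right (le_max_left _ _) (Real.exp_nonneg _)
    · exact (hasMaj_ownUnitInv (g := unitTorusGeoS L j.k j.Mn j.Msz) (liftBlk (fun p : Tor j.Mn × Fin (d + 1) => p.1) ι)
        (liftBlk (blkFine L j.k j.Mn ∘ kingPrV L j.k j.m j.Mn) ι) (liftMap (qbond L j.k j.Mn) ι ∘ liftMap (kingPrV L j.k j.m j.Mn) ι) (fun _ => rfl) htri (hdist j) (hd0 j)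
        hrow hσ.le hcr ha hC₀.le hδ2.le (by linarith) hG'ι hsmall).mono fun y y' => mul_le_mul_of_nonneg_right (le_max_left _ _) (Real.exp_nonneg _)
    · exact unitForm₀_comp_ownUnitInv (g := unitTorusGeoS L j.k j.Mn j.Msz) (liftBlk (fun p : Tor j.Mn × Fin (d + 1) => p.1) ι) (liftBlk (blkFine L j.k j.Mn) ι)
        (liftMap (qbond L j.k j.Mn) ι) (fun _ => rfl) htri (hdist j) (hd0 j) hrow hσ.le hcr ha hC₀.le (by linarith) hGι hsmall
    · exact unitForm₀_comp_ownUnitInv (g := unitTorusGeoS L j.k j.Mn j.Msz) (liftBlk (fun p : Tor j.Mn × Fin (d + 1) => p.1) ι)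
        (liftBlk (blkFine L j.k j.Mn ∘ kingPrV L j.k j.m j.Mn) ι) (liftMap (qbond L j.k j.Mn) ι ∘ liftMap (kingPrV L j.k j.m j.Mn) ι) (fun _ => rfl) htri (hdist j) (hd0 j)
        hrow hσ.le hcr ha hC₀.le (by linarith) hG'ι hsmall
    · have key := hasMaj_idef_unitForm₀ (g := unitTorusGeoS L j.k j.Mn j.Msz) (liftBlk (blkFine L j.k j.Mn) ι) (liftBlk (fun p : Tor j.Mn × Fin (d + 1) => p.1) ι)
        (liftMap (qbond L j.k j.Mn) ι) (liftMap (kingPrV L j.k j.m j.Mn) ι) (fun _ => rfl) (pow_ne_zero _ (pow_ne_zero _ (NeZero.ne L)))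
        (card_fibre_kingPrV_lift L j.k j.m j.Mn ι) a (mul_nonneg hC₂.le (hθ0 j)) (by simpa only [thetaV] using hDGι)
      have key' := hasMaj_exp_mono (hdist j) (mul_nonneg (mul_self_nonneg a) (mul_nonneg hC₂.le (hθ0 j))) (show δ / 2 ≤ δ by linarith) key
      exact key'.mono fun y y' => le_of_eq (by ring)
  refine ⟨βU, δ / 2, a * a * C₂, hβU, hδ2, hM₀, fun j => ?_, fun j => ?_, fun j => ?_, fun j => ?_, fun j => ?_⟩
  · by_cases hj : IsRecordIndex L j
    · rw [genuineWuV, if_pos hj]; exact (hRec j hj).1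
    · rw [genuineWuV, if_neg hj]; exact hId j
  · by_cases hj : IsRecordIndex L j
    · rw [genuineWuV', if_pos hj]; exact (hRec j hj).2.1
    · rw [genuineWuV', if_neg hj]; exact hId j
  · by_cases hj : IsRecordIndex L j
    · rw [genuineKuV, genuineWuV, if_pos hj, if_pos hj]; exact (hRec j hj).2.2.1
    · rw [genuineKuV, genuineWuV, if_neg hj, if_neg hj]; rfl
  · by_cases hj : IsRecordIndex L j
    · rw [genuineKuV', genuineWuV', if_pos hj, if_pos hj]; exact (hRec j hj).2.2.2.1
    · rw [genuineKuV', genuineWuV', if_neg hj, if_neg hj]; rfl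
  · by_cases hj : IsRecordIndex L j
    · rw [genuineKuV, genuineKuV', if_pos hj, if_pos hj]; exact (hRec j hj).2.2.2.2
    · rw [genuineKuV, genuineKuV', if_neg hj, if_neg hj, idef_id_id_eq, sub_self]
      exact (hasMaj_zero _ _).mono fun y y' => mul_nonneg (mul_nonneg hM₀ (hθ0 j)) (Real.exp_nonneg _)

variable (ι L)

/-- THE CERTIFIED WEIGHT WINDOW `a₀ > 0` of `unitRelDatum_genuineKing` (a choice; depends on the full propagator's uniform (1.110) letters only). [bookkeeping] -/
def genuineWeightBound (hLodd : Odd L) (hL2 : 2 ≤ L) {b : ℝ} (hb : 0 < b) : ℝ :=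
  Classical.choose (unitRelDatum_genuineKing (d := d) (ι := ι) (L := L) hLodd hL2 hb)

/-- `a₀ > 0`. [bookkeeping] -/
theorem genuineWeightBound_pos (hLodd : Odd L) (hL2 : 2 ≤ L) {b : ℝ} (hb : 0 < b) : 0 < genuineWeightBound (d := d) ι L hLodd hL2 hb :=
  (Classical.choose_spec (unitRelDatum_genuineKing (d := d) (ι := ι) (L := L) hLodd hL2 hb)).1

/-- In the window `0 < |a| ≤ a₀` the genuine unit datum holds. [bookkeeping] -/
theorem genuineWeightBound_spec (hLodd : Odd L) (hL2 : 2 ≤ L) {b : ℝ} (hb : 0 < b) {a : ℝ} (ha : a ≠ 0)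
    (haa : |a| ≤ genuineWeightBound (d := d) ι L hLodd hL2 hb) :
    ∃ βU δU M₀ : ℝ, UnitRelDatum (d := d) (ι := ι) (L := L) (genuineWuV ι L b a) (genuineWuV' ι L b a) (genuineKuV ι L b a) (genuineKuV' ι L b a) βU δU M₀ :=
  (Classical.choose_spec (unitRelDatum_genuineKing (d := d) (ι := ι) (L := L) hLodd hL2 hb)).2 a ha haa

end Datum

/-! ## §3 ★★★ `N15At` — all three conjuncts by name — with BOTH `U ≡ 1` layers genuine -/

section Face

variable (𝔄 : Type) [NormedRing 𝔄] [NormedAlgebra ℝ 𝔄] [CompleteSpace 𝔄] (ι : Type) [Fintype ι] [DecidableEq ι] (e : 𝔄 ≃L[ℝ] (ι → ℝ)) (L : ℕ) [NeZero L]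

/-- ★★★ **`N15At` — ALL THREE CONJUNCTS BY NAME, BOTH `U ≡ 1` FORMS GENUINE, BACKGROUND LIVE** (parallel-transport species; `d + 1 ≥ 2`, odd `L ≥ 3`, `c₃₅ > 0`, any `p`;
site coupling `b_S > 0` (G2's `Q′G′²Q′* ⊗ 1`), unit coupling `b > 0` and weight `0 < |a| ≤ genuineWeightBound` (this file's King form of `Δ_b⁻¹ ⊗ 1`)): R3s's
`n15At_vectorPiece_vWordsExpC_of_rel` at `siteRelDatum_genuine` AND `unitRelDatum_genuineKing` — operator = F16 (gauge field `A′` the datum, (3.35) smallness), site and unit = the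
genuine `U ≡ 1` forms of Bałaban's full propagator on the family of record, dressing words of the piece; NO `U ≡ 1` datum displayed. [bookkeeping] -/
theorem n15At_vectorPiece_vWordsExpC_genuineBoth (hd : 1 ≤ d) (hLodd : Odd L) (hL2 : 2 ≤ L) {c35 : ℝ} (hc35 : 0 < c35) (p : ℝ) {bS b : ℝ} (hbS : 0 < bS) (hb : 0 < b)
    {a : ℝ} (ha : a ≠ 0) (haa : |a| ≤ genuineWeightBound (d := d) ι L hLodd hL2 hb) :
    N15At { I := VecIndexS d L, c35 := c35, p := p, pi := v1GVecInstance (d := d) 𝔄 ι L (by omega),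
            Kop := vWGCVecFamily4 (d := d) 𝔄 ι e L a (by omega) (expFc ι e L) (expFsc ι e L) (expFf ι e L) (expFsf ι e L),
            Ksite := vWGCVecSiteRelKernel (d := d) 𝔄 ι e L a (by omega) (expFc ι e L) (expFsc ι e L) (expFf ι e L) (expFsf ι e L)
              (genuineWsV ι L bS) (genuineWsV' ι L bS) (genuineKsV ι L bS) (genuineKsV' ι L bS),
            Kunit := vWGCVecUnitRelKernel (d := d) 𝔄 ι e L a (by omega) (expFc ι e L) (expFsc ι e L) (expFf ι e L) (expFsf ι e L)
              (genuineWuV ι L b a) (genuineWuV' ι L b a) (genuineKuV ι L b a) (genuineKuV' ι L b a),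
            inΛ := fun _ _ => True, unitDist := fun j => (unitTorusGeoS L j.k j.Mn j.Msz).dist } := by
  obtain ⟨βW, δW, M₀, hS⟩ := siteRelDatum_genuine (d := d) (ι := ι) (L := L) (b := bS) hLodd hL2 hbS
  obtain ⟨βU, δU, MU, hU⟩ := genuineWeightBound_spec (d := d) ι L hLodd hL2 hb ha haa
  exact n15At_vectorPiece_vWordsExpC_of_rel (d := d) e a hd (by omega) hL2 hc35 p hS hU

/-- **NE2⁰-UNIT for the relative unit family AT THE GENUINE KING-FORM DATUM** (parallel-transport species), E4's corollary. [cite: King1986, Lemma 4.5 (4.38) p.674 (A = 0 template, shape)] -/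
theorem ne2ZeroUnit_vectorPiece_vWordsExpC_genuineKing (hd : 1 ≤ d) (hLodd : Odd L) (hL2 : 2 ≤ L) {b : ℝ} (hb : 0 < b) {a : ℝ} (ha : a ≠ 0)
    (haa : |a| ≤ genuineWeightBound (d := d) ι L hLodd hL2 hb) :
    NE2ZeroUnit (v1GVecInstance (d := d) 𝔄 ι L (by omega))
      (vWGCVecUnitRelKernel (d := d) 𝔄 ι e L a (by omega) (expFc ι e L) (expFsc ι e L) (expFf ι e L) (expFsf ι e L)
        (genuineWuV ι L b a) (genuineWuV' ι L b a) (genuineKuV ι L b a) (genuineKuV' ι L b a))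
      (fun _ _ => True) (fun j => (unitTorusGeoS L j.k j.Mn j.Msz).dist) := by
  obtain ⟨βU, δU, MU, hU⟩ := genuineWeightBound_spec (d := d) ι L hLodd hL2 hb ha haa
  exact ne2ZeroUnit_vectorPiece_vWordsExpC_rel (d := d) 𝔄 ι e L a hd (by omega) hL2 hU

variable {N : ℕ} [NeZero N] in
/-- **`S_N15` FOR EVERY PARALLEL-TRANSPORT-SPECIES READING AT THE TWO GENUINE DATA** (weight in the certified window): the K4 stub closed over every rate-carrier predicate whose
NE2 component is the record above. [bookkeeping] -/
theorem s_N15_of_vWordsExpCGenuineBothReading (hd : 1 ≤ d) (hLodd : Odd L) (hL2 : 2 ≤ L) {b : ℝ} (hb : 0 < b) (RRec : RateRecordPred N)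
    (hread : ∀ (F : T4Family) (D : Datum F N) (g₀ : ℕ → ℝ) (os : List (ULoop F)) (R : RateCarriers N), RRec F D g₀ os R →
      ∃ (a c35 p bS : ℝ), a ≠ 0 ∧ |a| ≤ genuineWeightBound (d := d) ι L hLodd hL2 hb ∧ 0 < c35 ∧ 0 < bS ∧
        R.ne2 = { I := VecIndexS d L, c35 := c35, p := p, pi := v1GVecInstance (d := d) 𝔄 ι L (by omega),
                  Kop := vWGCVecFamily4 (d := d) 𝔄 ι e L a (by omega) (expFc ι e L) (expFsc ι e L) (expFf ι e L) (expFsf ι e L),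
                  Ksite := vWGCVecSiteRelKernel (d := d) 𝔄 ι e L a (by omega) (expFc ι e L) (expFsc ι e L) (expFf ι e L) (expFsf ι e L)
                    (genuineWsV ι L bS) (genuineWsV' ι L bS) (genuineKsV ι L bS) (genuineKsV' ι L bS),
                  Kunit := vWGCVecUnitRelKernel (d := d) 𝔄 ι e L a (by omega) (expFc ι e L) (expFsc ι e L) (expFf ι e L) (expFsf ι e L)
                    (genuineWuV ι L b a) (genuineWuV' ι L b a) (genuineKuV ι L b a) (genuineKuV' ι L b a),
                  inΛ := fun _ _ => True, unitDist := fun j => (unitTorusGeoS L j.k j.Mn j.Msz).dist }) :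
    S_N15 RRec := by
  intro F D g₀ os R hR
  obtain ⟨a, c35, p, bS, ha, haa, hc35, hbS, hne2⟩ := hread F D g₀ os R hR
  rw [hne2]
  exact n15At_vectorPiece_vWordsExpC_genuineBoth 𝔄 ι e L hd hLodd hL2 hc35 p hbS hb ha haa

end Face

end Summit.QuantumFields.YangMills.BalabanUVNodes.N15.VectorPiece
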